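import Literature.IUT.HodgeArakelov.BadPrimeGaussianMonoidsGenuineRecordRestrictionIsoAct

/-!
# [IUTchII] Cor 3.5 (ii) «`Ψ^ι_env(M^Θ_*) ⥲ Ψ_ξ(M^Θ_*)`» at the genuine `θ_env` data over `ℚ̄_pˣ` — ACTION-LEVEL JUNCTION AND
# `horb` DISCHARGED for the pointed-inversion pair family (GAP G-w4d004-1 repair, part 3: the headline of row
# «COR35ii-HORB-GENUINE» re-pointed to the print-faithful identification of the labelled copies; proof-only)

S. Mochizuki, *Inter-universal Teichmüller theory II*, kurims Dec-2020 manuscript, Cor 3.5 (i)/(ii) pp. 94–95, Cor 2.8 (i) p. 82, Prop 2.2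
(ii) p. 66 [cite: Mochizuki2012, Cor 3.5 (ii) p.95]. Claim key DISPUTED (D-0012). PROOF-ONLY companion (abc-iut cell, layer L6,
seat abc-iut-w4-d004 gen 4; node **IUTchII:Cor3.5(ii)**; finding F-w4d004-g4-1). NO definition, NO `Prop` fact, NO instance. ONE theorem
**`exists_unique_restrictionIso'_toRecord_padic_of_evaluation_act_pairRhoLim`** = file 2's `…_pairRhoLim` (p438435) with the
typed-too-strong hom-equality `hφ` REPLACED by the action-level junction `hφAct` (via `…RestrictionIsoAct`'s
`exists_unique_restrictionIso'_toRecord_padic_of_evaluation_act`), `horb` supplied by `horb_toRecord_pairRhoLim`. Remaining inputs: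
(R1)(R2)(R3) of [IUTchII] Prop 2.2 (ii) at the model, `hker`, `μ ⊆ O`, sections with `hφAct` (true at the genuine data,
`hφAct_of_aug_eq`) + `hact` + one finite-index `ε`-image, model data, (E2) values. HONEST FRAMING: composition of landed theorems; no
side taken on [IUTchIII] Cor 3.12; typed ≠ proved.
-/

noncomputable section

namespace Literature.IUT.HodgeArakelov

namespace EtaleLevels

open Literature.AnabelianGeometry.EtaleTheta CohomologySystemOfContH1 EtaleThetaDataOfSetting TemperedThetaMonoids
  BadPrimeGaussianMonoids

variable {p : ℕ} [Fact p.Prime] {D : Literature.AnabelianGeometry.EtaleTheta.ThetaSetting p}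
  {E : D.EtaleThetaData} {l : ℕ} (C : E.DoubleUnderline l) (hC : D.Compat) (hS : D.Sec2Hyps)
  (hl : l.Prime) (hp2 : p ≠ 2) (hpl : p ≠ l) (hζ : ∃ ζ : D.K, IsPrimitiveRoot ζ (4 * l))
  (mods : ∀ M : ℕ+, D.CyclotomeMod l M)
  (f : contCocycles D.toTheta D.DeltaTheta C.GtpYdduu) (hf : f ∈ C.rootCocycles hC)
  (hmods : ∀ (M M' : ℕ+) (h : (M : ℕ) ∣ (M' : ℕ)) (x : D.lDeltaTheta l),
    MuN.red p M M' h ((mods M').red x) = (mods M).red x)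
  (h15 : Literature.AnabelianGeometry.EtaleTheta.ThetaSetting.Prop15iii E hC) (L : C.CuspLabels)
  (hZ : ∀ M : ℕ+, Nonempty (ModelCyclotomes.lDeltaQuot (C.rigidData (mods M) hC hS h15 L) ≃*
    Literature.IUT.HodgeTheaters.ZHat))
  (hcharY : EtaleThetaDataOfSetting.PiYddCharacteristic C)
  (hlim : Function.Bijective (rigidLimHom C hC hS hl hp2 hpl hζ mods f hf hmods h15 L hZ))
  [(EtaleThetaDataOfSetting.PiYdd C).Normal]
  {Iota : Type}
  (iota : Iota → ((thetaEnvData C hC hS hl hp2 hpl hζ mods f hf hmods h15 L hZ hcharY hlim).D.coh.lim ≃+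
    (thetaEnvData C hC hS hl hp2 hpl hζ mods f hf hmods h15 L hZ hcharY hlim).D.coh.lim))
  {Lbl : Type*} {P₀ : TopGroup.{0}} (φ₀ : P₀ →* D.GtpTheta) (s : Lbl → (P₀ →* Pi C))
  (hι : ∀ t, Continuous ((MonoidHom.id (Pi C)).comp (s t)))
  (hN : ∀ t, (⊤ : Subgroup P₀).map ((MonoidHom.id (Pi C)).comp (s t)) ≤ PiYdd C)
  -- THE ACTION-LEVEL JUNCTION (replaces `hφ : ∀ t, (phi C).comp (s t) = φ₀`)
  (hφAct : ∀ (t : Lbl) (g : P₀) (a : D.lDeltaTheta l),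
    MulAut.conjNormal (phi C (((MonoidHom.id (Pi C)).comp (s t)) g)) a = MulAut.conjNormal (φ₀ g) a)

section Padic

variable [TopologicalSpace (PadicAlgCl p)ˣ]
  (c : CyclotomeCoefficients (phi C) (D.lDeltaTheta l) (PadicAlgCl p)ˣ)
  (hA : ∀ b : (PadicAlgCl p)ˣ, IsOpen (MulAction.stabilizer (Pi C) b : Set (Pi C)))
  (hfi : ∀ b : (PadicAlgCl p)ˣ, (MulAction.stabilizer (Pi C) b).FiniteIndex)
  (O : Submonoid (PadicAlgCl p)ˣ)
  [MulDistribMulAction P₀ (PadicAlgCl p)ˣ]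
  (c₀ : CyclotomeCoefficients φ₀ (D.lDeltaTheta l) (PadicAlgCl p)ˣ)
  (hA₀ : ∀ b : (PadicAlgCl p)ˣ, IsOpen (MulAction.stabilizer P₀ b : Set P₀))
  (hfi₀ : ∀ b : (PadicAlgCl p)ˣ, (MulAction.stabilizer P₀ b).FiniteIndex)
  -- the module of FUNCTIONS with its Kummer data over `Π^tp_{Ÿ̲̲}`
  {Afun : Type} [CommGroup Afun] [MulDistribMulAction (Pi C) Afun] [TopologicalSpace Afun] [RootableBy Afun ℕ]
  (cf : CyclotomeCoefficients (phi C) (D.lDeltaTheta l) Afun)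
  (hAf : ∀ a : Afun, IsOpen (MulAction.stabilizer (Pi C) a : Set (Pi C)))
  (hfif : ∀ a : Afun, (MulAction.stabilizer (Pi C) a).FiniteIndex)


/-- **IUTchII:Cor3.5(ii)** (kurims p.95) at the genuine `θ_env` data over `ℚ̄_pˣ`, ACTION-LEVEL junction, `horb` DISCHARGED for the
pointed-inversion pair family (`iota i₀ = pairRhoLim C α β …`): the UNIQUE restriction isomorphism `Ψ^{i₀}_env(𝕄_*) ⥲ Ψ_ξ`, with (K),
(R), (E1), `hU`, `hUsurj`, `hinj`, `hq₀`, `horb` all derived. [cite: Mochizuki2012, Cor 3.5 (ii) p.95] -/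
theorem exists_unique_restrictionIso'_toRecord_padic_of_evaluation_act_pairRhoLim (hc : Function.Bijective c.hom)
    -- `μ ⊆ O` (with inverses): torsion classes are units of `Ψ_cns`
    (hOtors : ∀ a : (PadicAlgCl p)ˣ, IsOfFinOrder a → a ∈ O ∧ a⁻¹ ∈ O)
    -- (R1) the pointed-inversion PAIR, reversing the `ℤ`-torsor
    (α : (Pi C) ≃ₜ* (Pi C)) (β : D.GtpTheta ≃ₜ* D.GtpTheta) (hφαβ : ∀ g, β (phi C g) = phi C (α g))
    (hAβ : ∀ a : D.GtpTheta, a ∈ D.lDeltaTheta l ↔ β a ∈ D.lDeltaTheta l)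
    (hH : ∀ x, x ∈ PiYdd C ↔ α x ∈ PiYdd C)
    (γ ε : Pi C) (hγ : C.toLZ γ = Multiplicative.ofAdd 1) (hε₁ : (ε : D.PiTemp) ∈ D.GtpY)
    (hε₂ : (ε : D.PiTemp) ∉ D.GtpYdd) (hαγ : C.toLZ (α γ) = Multiplicative.ofAdd (-1))
    -- (R2)(R3) [EtTh] Prop 1.4 at the class level
    (hsign : ∃ κ : ContH1 (phi C) (D.lDeltaTheta l) (PiYdd C ⊓ ⊤), κ ^ 2 = 1 ∧
      ContH1.conj (phi C) (D.lDeltaTheta l) ε (rootLiftClass C) = rootLiftClass C * κ)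
    (hroot : ∃ τ₀ : Pi C, (τ₀ : D.PiTemp) ∈ D.GtpY ∧
      h1TopAut (phi C) (D.lDeltaTheta l) (PiYdd C) α β hφαβ (fun a ha => (hAβ a).mp ha) hH (rootLiftClass C) =
        ContH1.conj (phi C) (D.lDeltaTheta l) τ₀ (rootLiftClass C))
    (hfree : ∀ m n : ℤ, IsOfFinAddOrder
      ((h1Top C).symm (Additive.ofMul (ContH1.conj (phi C) (D.lDeltaTheta l) (γ ^ m) (rootLiftClass C))) -
        (h1Top C).symm (Additive.ofMul (ContH1.conj (phi C) (D.lDeltaTheta l) (γ ^ n) (rootLiftClass C)))) →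
      m = n)
    (hker : ∀ y : (coh C).H1 ⊤, (coh C).toLim ⊤ y = 0 → IsOfFinAddOrder y)
    (hc₀ : Function.Bijective c₀.hom) (hc₀c : ∀ ζ, c₀.hom ζ = c.hom ζ)
    (hact : ∀ (t : Lbl) (g : P₀) (a : (PadicAlgCl p)ˣ), g • a = s t g • a) (t₁ : Lbl)
    [((EtaleThetaDataOfSetting.aug C).comp (s t₁)).range.FiniteIndex]
    {i₀ : Iota} (hi₀ : iota i₀ = pairRhoLim C α β hφαβ hAβ hH)
    {θ : ((thetaEnvData C hC hS hl hp2 hpl hζ mods f hf hmods h15 L hZ hcharY hlim).toRecord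
        (h1LimConjMulAut (phi C) (D.lDeltaTheta l) (PiYdd C))
        (h1LimKummerOn (phi C) (D.lDeltaTheta l) (PiYdd C) c hA hfi O) iota).H}
    (hθ : θ ∈ ((thetaEnvData C hC hS hl hp2 hpl hζ mods f hf hmods h15 L hZ hcharY hlim).toRecord
        (h1LimConjMulAut (phi C) (D.lDeltaTheta l) (PiYdd C))
        (h1LimKummerOn (phi C) (D.lDeltaTheta l) (PiYdd C) c hA hfi O) iota).thetaEnv i₀)
    (R : Lbl → (((thetaEnvData C hC hS hl hp2 hpl hζ mods f hf hmods h15 L hZ hcharY hlim).toRecord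
        (h1LimConjMulAut (phi C) (D.lDeltaTheta l) (PiYdd C))
        (h1LimKummerOn (phi C) (D.lDeltaTheta l) (PiYdd C) c hA hfi O) iota).H →*
      Multiplicative (h1Lim φ₀ (D.lDeltaTheta l) (⊤ : Subgroup P₀) ⊥)))
    (hR : ∀ t y, Multiplicative.toAdd (R t y) =
      h1LimComapAct (phi C) (D.lDeltaTheta l) ((MonoidHom.id (Pi C)).comp (s t)) (hι t) φ₀ (hφAct t) (hN t)
        (AddEquiv.additiveMultiplicative (h1Lim (phi C) (D.lDeltaTheta l) (PiYdd C) ⊥) (Additive.ofMul y)))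
    (ev : Lbl → (Afun →* (PadicAlgCl p)ˣ)) (hev : ∀ (t : Lbl) (g : P₀) (a : Afun), ev t (s t g • a) = g • ev t a)
    (hcev : ∀ (t : Lbl) (ζ : cyclotome Afun), c₀.hom (cyclotome.map (ev t) ζ) = cf.hom ζ)
    {fΘ : Afun}
    (hθf : AddEquiv.additiveMultiplicative (h1Lim (phi C) (D.lDeltaTheta l) (PiYdd C) ⊥) (Additive.ofMul θ) =
      Multiplicative.toAdd (h1LimKummer (phi C) (D.lDeltaTheta l) (PiYdd C) cf hAf hfif fΘ))
    (q : Lbl → O) (hval : ∀ t, ev t fΘ = (q t : (PadicAlgCl p)ˣ)) (t₀ : Lbl) (hq : ¬ IsUnit (q t₀)) :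
    ∃! e : ((thetaEnvData C hC hS hl hp2 hpl hζ mods f hf hmods h15 L hZ hcharY hlim).toRecord
          (h1LimConjMulAut (phi C) (D.lDeltaTheta l) (PiYdd C))
          (h1LimKummerOn (phi C) (D.lDeltaTheta l) (PiYdd C) c hA hfi O) iota).thetaMonoid i₀ ≃*
        gaussianMonoid (fun t =>
          ((R t).comp (((thetaEnvData C hC hS hl hp2 hpl hζ mods f hf hmods h15 L hZ hcharY hlim).toRecord
              (h1LimConjMulAut (phi C) (D.lDeltaTheta l) (PiYdd C))
              (h1LimKummerOn (phi C) (D.lDeltaTheta l) (PiYdd C) c hA hfi O) iota).thetaMonoid i₀).subtype).codRestrict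
            (MonoidHom.mrange (h1LimKummerOn φ₀ (D.lDeltaTheta l) ⊤ c₀ hA₀ hfi₀ O))
            (restriction_mem_mrange_gen
              ((thetaEnvData C hC hS hl hp2 hpl hζ mods f hf hmods h15 L hZ hcharY hlim).toRecord
                (h1LimConjMulAut (phi C) (D.lDeltaTheta l) (PiYdd C))
                (h1LimKummerOn (phi C) (D.lDeltaTheta l) (PiYdd C) c hA hfi O) iota)
              (h1LimKummerOn (phi C) (D.lDeltaTheta l) (PiYdd C) c hA hfi O)
              (h1LimKummerOn φ₀ (D.lDeltaTheta l) ⊤ c₀ hA₀ hfi₀ O)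
              (fun t => (R t).comp (((thetaEnvData C hC hS hl hp2 hpl hζ mods f hf hmods h15 L hZ hcharY hlim).toRecord
                (h1LimConjMulAut (phi C) (D.lDeltaTheta l) (PiYdd C))
                (h1LimKummerOn (phi C) (D.lDeltaTheta l) (PiYdd C) c hA hfi O) iota).thetaMonoid i₀).subtype)
              q (hκ_padic C c hA hfi O hc) (ThetaEnvData.toRecord_constantMonoid _ _ _ _) hθ
              (horb_toRecord_pairRhoLim C hC hS hl hp2 hpl hζ mods f hf hmods h15 L hZ hcharY hlim
                iota c hA hfi O hc hOtors α β hφαβ hAβ hH γ ε hγ hε₁ hε₂ hαγ hsign hroot hfree hker hi₀ hθ)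
              (fun t m hm => hRκ_toRecord_act C hC hS hl hp2 hpl hζ mods f hf hmods h15 L hZ hcharY hlim iota φ₀ s hι hN
                hφAct c hA hfi O c₀ hA₀ hfi₀ hc₀c hact R hR t m hm)
              (fun t => hRθ_toRecord_of_evaluation_act C hC hS hl hp2 hpl hζ mods f hf hmods h15 L hZ hcharY hlim iota φ₀ s hι
                hN hφAct c hA hfi O c₀ hA₀ hfi₀ cf hAf hfif R hR ev hev hcev hθf q hval t) t)
            ⟨θ, thetaEnv_subset_thetaMonoid
              ((thetaEnvData C hC hS hl hp2 hpl hζ mods f hf hmods h15 L hZ hcharY hlim).toRecord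
                (h1LimConjMulAut (phi C) (D.lDeltaTheta l) (PiYdd C))
                (h1LimKummerOn (phi C) (D.lDeltaTheta l) (PiYdd C) c hA hfi O) iota) i₀ hθ⟩),
      ∀ x, ((e x : gaussianMonoid _) : Lbl → MonoidHom.mrange (h1LimKummerOn φ₀ (D.lDeltaTheta l) ⊤ c₀ hA₀ hfi₀ O)) =
        MonoidHom.pi (fun t =>
          ((R t).comp (((thetaEnvData C hC hS hl hp2 hpl hζ mods f hf hmods h15 L hZ hcharY hlim).toRecord
              (h1LimConjMulAut (phi C) (D.lDeltaTheta l) (PiYdd C))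
              (h1LimKummerOn (phi C) (D.lDeltaTheta l) (PiYdd C) c hA hfi O) iota).thetaMonoid i₀).subtype).codRestrict
            (MonoidHom.mrange (h1LimKummerOn φ₀ (D.lDeltaTheta l) ⊤ c₀ hA₀ hfi₀ O))
            (restriction_mem_mrange_gen
              ((thetaEnvData C hC hS hl hp2 hpl hζ mods f hf hmods h15 L hZ hcharY hlim).toRecord
                (h1LimConjMulAut (phi C) (D.lDeltaTheta l) (PiYdd C))
                (h1LimKummerOn (phi C) (D.lDeltaTheta l) (PiYdd C) c hA hfi O) iota)
              (h1LimKummerOn (phi C) (D.lDeltaTheta l) (PiYdd C) c hA hfi O)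
              (h1LimKummerOn φ₀ (D.lDeltaTheta l) ⊤ c₀ hA₀ hfi₀ O)
              (fun t => (R t).comp (((thetaEnvData C hC hS hl hp2 hpl hζ mods f hf hmods h15 L hZ hcharY hlim).toRecord
                (h1LimConjMulAut (phi C) (D.lDeltaTheta l) (PiYdd C))
                (h1LimKummerOn (phi C) (D.lDeltaTheta l) (PiYdd C) c hA hfi O) iota).thetaMonoid i₀).subtype)
              q (hκ_padic C c hA hfi O hc) (ThetaEnvData.toRecord_constantMonoid _ _ _ _) hθ
              (horb_toRecord_pairRhoLim C hC hS hl hp2 hpl hζ mods f hf hmods h15 L hZ hcharY hlim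
                iota c hA hfi O hc hOtors α β hφαβ hAβ hH γ ε hγ hε₁ hε₂ hαγ hsign hroot hfree hker hi₀ hθ)
              (fun t m hm => hRκ_toRecord_act C hC hS hl hp2 hpl hζ mods f hf hmods h15 L hZ hcharY hlim iota φ₀ s hι hN
                hφAct c hA hfi O c₀ hA₀ hfi₀ hc₀c hact R hR t m hm)
              (fun t => hRθ_toRecord_of_evaluation_act C hC hS hl hp2 hpl hζ mods f hf hmods h15 L hZ hcharY hlim iota φ₀ s hι
                hN hφAct c hA hfi O c₀ hA₀ hfi₀ cf hAf hfif R hR ev hev hcev hθf q hval t) t)) x :=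
  exists_unique_restrictionIso'_toRecord_padic_of_evaluation_act C hC hS hl hp2 hpl hζ mods f hf hmods h15 L hZ hcharY hlim iota φ₀ s
    hι hN hφAct c hA hfi O c₀ hA₀ hfi₀ cf hAf hfif hc hc₀ hc₀c hact t₁ hθ
    (horb_toRecord_pairRhoLim C hC hS hl hp2 hpl hζ mods f hf hmods h15 L hZ hcharY hlim iota c hA hfi O hc hOtors α β hφαβ
      hAβ hH γ ε hγ hε₁ hε₂ hαγ hsign hroot hfree hker hi₀ hθ)
    R hR ev hev hcev hθf q hval t₀ hq

end Padic

end EtaleLevels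

end Literature.IUT.HodgeArakelov

end
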